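import Literature.Barriers.CriticalPhenomena.PlaquetteWalkHoleRootPrefixLoop
import HarnessLib

/-!
# Barrier catalogue (SAWScalingLimit): the KISS LOOP of a doubly visited plaquette — loop data, edge classification, winding-number transport
(«KISS LOOP», infrastructure for the TAIL LEMMA of the «RECTANGLE COEFFICIENT» line)

`Z → ∞` limit model of the printed Yang–Baxter weights [GlazmanManolescu2019, §1, eq. (1)]. A plaquette crossed twice by a plaquette walk carries the two
non-crossing corner arcs (`w₁`) or the two co-corner arcs (`w₂`) [GlazmanManolescu2019, §1, Fig. 1]; between the first visit `ta` and the second visit `tb`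
the walk's mesh-4 drawing (`YangBaxterSAWBoundaryWinding`: `vtx (2i+1) = ptIn i`, `vtx (2i+2) = ptOut i`) closes up, through the CHORD joining the two entry
inner points inside the plaquette, into a closed polygon — the KISS LOOP. This file sets up its data exactly as `PlaquetteWalkHoleRootPrefixLoop` does for the
prefix loop: vertices `YBWalk.kPt`, count `kN`, list `kList`, closed edges `kEdge`, winding number `windK`; the edges are arc segments (`kEdge_arc`), crossing
segments (`kEdge_cross`) and the chord (`kEdge_chord`, an `arcSeg` between two ADJACENT sides); and the winding number is constant along every segment
missing the loop (`windK_eq_of_segment`, [AhlforsCA1979, Ch. 4 §2.1]).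

Use (venture lane «pcv-sawmu», b-engine-1 g25, DESIGN-next-g25 §2bis/§2ter): the TAIL LEMMA — a tail that may turn only at doubly visited plaquettes
cannot return onto a head plaquette — by the jump of `windK` across the chord versus its constancy along the before- and after-parts of the walk; with
`PlaquetteWalkHoleRootForcedFrame` this is (R2) «no doubly visited plaquette» for the cost-5 wound walks with isolated first turn.
[CourantRobbins1958, Ch. V Appendix §2 (polygons: the even–odd rule)] [AhlforsCA1979, Ch. 4 §2.1] [GlazmanManolescu2019 §1 Fig. 1, eq. (1)]
-/

noncomputable section

open Set Function Complex
open Literature.Topology.PlaneTopology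

namespace Literature.Probability.RandomPlanarGeometry.SAW.YangBaxter

open private crossSeg_side_eq from Literature.Probability.RandomPlanarGeometry.YangBaxterSAWExcursionJordan

namespace YBWalk

variable {D : Set Face} {a z : MidEdge}

/-- Vertices of the kiss loop: `k ↦ ptIn (ta + k/2)` (even), `ptOut (ta + k/2)` (odd), for `k ≤ 2 (tb − ta)`.
[cite: CourantRobbins1958, Ch. V Appendix §2 (The Jordan Curve Theorem for Polygons: the even–odd rule)] -/
def kPt (γ : YBWalk D a z) (ta k : ℕ) : ℤ × ℤ := if k % 2 = 0 then γ.ptIn (ta + k / 2) else γ.ptOut (ta + k / 2)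

/-- Number of vertices of the kiss loop. [cite: CourantRobbins1958, Ch. V Appendix §2 (polygons)] -/
def kN (ta tb : ℕ) : ℕ := 2 * (tb - ta) + 1

/-- The vertex list, as complex points. [cite: CourantRobbins1958, Ch. V Appendix §2 (polygons)] -/
def kList (γ : YBWalk D a z) (ta tb : ℕ) : List ℂ := (List.range (kN ta tb)).map fun k => toC (γ.kPt ta k)

/-- The closed edge `k` (cyclic indices); the edge `2 (tb − ta)` is the CHORD `ptIn tb → ptIn ta`. [cite: CourantRobbins1958, Ch. V Appendix §2 (polygons)] -/
def kEdge (γ : YBWalk D a z) (ta tb k : ℕ) : Set ℂ := segment ℝ (toC (γ.kPt ta k)) (toC (γ.kPt ta ((k + 1) % kN ta tb)))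

/-- The winding number of the kiss loop. [cite: AhlforsCA1979, Ch. 4 §2.1 (index of a point with respect to a closed curve)] -/
def windK (γ : YBWalk D a z) (ta tb : ℕ) (p : ℂ) : ℤ := wind (fun t ↦ polygonLoop (γ.kList ta tb) t - p)

variable {γ : YBWalk D a z} {ta tb : ℕ}

/-- Even vertices are entry inner points. [cite: CourantRobbins1958, Ch. V Appendix §2 (polygons)] -/
theorem kPt_even (i : ℕ) : γ.kPt ta (2 * i) = γ.ptIn (ta + i) := by
  unfold kPt; rw [if_pos (by omega)]; congr 1; omega

/-- Odd vertices are exit inner points. [cite: CourantRobbins1958, Ch. V Appendix §2 (polygons)] -/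
theorem kPt_odd (i : ℕ) : γ.kPt ta (2 * i + 1) = γ.ptOut (ta + i) := by
  unfold kPt; rw [if_neg (by omega)]; congr 1; omega

/-- The loop has `2 (tb − ta) + 1` vertices. [cite: CourantRobbins1958, Ch. V Appendix §2 (polygons)] -/
@[simp] theorem length_kList : (γ.kList ta tb).length = kN ta tb := by simp [kList]

/-- The `k`-th vertex of the list. [cite: CourantRobbins1958, Ch. V Appendix §2 (polygons)] -/
theorem kList_getElem {k : ℕ} (hk : k < (γ.kList ta tb).length) : (γ.kList ta tb)[k] = toC (γ.kPt ta k) := by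
  simp [kList]

/-- An even edge is the arc segment of the arc `ta + i`. [cite: GlazmanManolescu2019, §1, Fig. 1 (the arcs of a plaquette)] -/
theorem kEdge_arc {i : ℕ} (hi : ta + i < tb) :
    γ.kEdge ta tb (2 * i) = arcSeg (γ.fc (ta + i)) (γ.sIn (ta + i)) (γ.sOut (ta + i)) := by
  rw [kEdge, Nat.mod_eq_of_lt (by rw [kN]; omega), kPt_even, kPt_odd, arcSeg, YBWalk.ptIn, YBWalk.ptOut]

/-- The closing edge is the chord inside the kiss plaquette between the two entry inner points. [cite: GlazmanManolescu2019, §1, Fig. 1 (the configurations `w₁`, `w₂`: two arcs in one plaquette)] -/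
theorem kEdge_chord (hab : ta < tb) (hkiss : γ.fc tb = γ.fc ta) :
    γ.kEdge ta tb (2 * (tb - ta)) = arcSeg (γ.fc ta) (γ.sIn tb) (γ.sIn ta) := by
  rw [kEdge, show 2 * (tb - ta) + 1 = kN ta tb by rw [kN], Nat.mod_self, kPt_even, show ta + (tb - ta) = tb by omega,
    show (0 : ℕ) = 2 * 0 by rfl, kPt_even, Nat.add_zero, arcSeg, YBWalk.ptIn, YBWalk.ptIn, hkiss]

/-- An odd edge between two loop arcs is the crossing segment of the mid-edge between them. [cite: GlazmanManolescu2019, §1, Fig. 1 (arcs join mid-edges)] -/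
theorem kEdge_cross {i : ℕ} (hi : ta + i + 1 ≤ tb) (htb : tb < γ.arcs.length) :
    γ.kEdge ta tb (2 * i + 1) = crossSeg (γ.nth (ta + i + 1)) := by
  rw [kEdge, Nat.mod_eq_of_lt (by rw [kN]; omega), kPt_odd, show 2 * i + 1 + 1 = 2 * (i + 1) by ring, kPt_even,
    show ta + (i + 1) = ta + i + 1 by ring, YBWalk.ptIn, YBWalk.ptOut]
  obtain ⟨-, hout, -⟩ := γ.side_sIn_nth (i := ta + i) (by omega)
  obtain ⟨hin, -, -⟩ := γ.side_sIn_nth (i := ta + i + 1) (by omega)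
  have hface : γ.fc (ta + i) ≠ γ.fc (ta + i + 1) := γ.fc_succ_ne (by omega)
  rw [← hout, crossSeg_side_eq, innerPt_eq (γ.fc (ta + i + 1)), hin, ← hout,
    nIn_eq_neg_of_side_eq (hout.trans hin.symm) hface, sub_eq_add_neg]

/-- The vertex list is nonempty. [folklore] -/
private theorem kList_pos : 0 < (γ.kList ta tb).length := by rw [length_kList, kN]; omega

/-- The cyclically next vertex. [folklore] -/
private theorem kList_getElem_succ (k : ℕ) :
    (γ.kList ta tb)[(k + 1) % (γ.kList ta tb).length]'(Nat.mod_lt _ kList_pos) = toC (γ.kPt ta ((k + 1) % kN ta tb)) := by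
  rw [kList_getElem]; simp only [length_kList]

/-- A point of the kiss loop lies on one of its closed edges. [cite: CourantRobbins1958, Ch. V Appendix §2 (polygons)] -/
theorem exists_mem_kEdge_of_mem_range {x : ℂ} (hx : x ∈ range (polygonLoop (γ.kList ta tb))) :
    ∃ k, k < kN ta tb ∧ x ∈ γ.kEdge ta tb k := by
  have hl : γ.kList ta tb ≠ [] := List.ne_nil_of_length_pos kList_pos
  rw [range_polygonLoop hl, mem_iUnion] at hx
  obtain ⟨k, hk⟩ := hx
  have hk2 : (k : ℕ) < kN ta tb := by simpa using k.2
  rw [kList_getElem, kList_getElem_succ] at hk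
  exact ⟨k, hk2, hk⟩

/-- A point off the closed edges is off the loop. [cite: CourantRobbins1958, Ch. V Appendix §2 (polygons)] -/
theorem not_mem_range_k {b : ℂ} (hb : ∀ k < kN ta tb, b ∉ γ.kEdge ta tb k) : b ∉ range (polygonLoop (γ.kList ta tb)) := by
  intro h
  obtain ⟨k, hk, hx⟩ := exists_mem_kEdge_of_mem_range h
  exact hb k hk hx

/-- **Transport**: a segment missing the closed edges of the kiss loop has the same winding number at its two ends.
[cite: AhlforsCA1979, Ch. 4 §2.1 (index of a point with respect to a closed curve)] -/
theorem windK_eq_of_segment {p q : ℂ} (hpq : ∀ x ∈ segment ℝ p q, ∀ k < kN ta tb, x ∉ γ.kEdge ta tb k) :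
    γ.windK ta tb p = γ.windK ta tb q := by
  have key := wind_affine_sub_eq_of_segment (L := polygonLoop (γ.kList ta tb)) (a := 0) (b := 1) zero_le_one
    (continuous_polygonLoop _).continuousOn (by simpa using (periodic_polygonLoop (γ.kList ta tb) 0).symm)
    (p := p) (q := q) (fun x hx hxL => not_mem_range_k (hpq x hx) (image_subset_range _ _ hxL))
  simpa [windK] using key

/- ROAD MAP (for the heir; DESIGN-next-g25 §2bis/§2ter): under «no plaquette has its second visit before `tb`» show (1) the before-part
`vtx 0 … vtx (2 ta)` misses every `kEdge`; (2) the after-part `vtx (2 tb + 2) … vtx (2 n + 1)` misses every `kEdge` (at kiss cells the two arcs are the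
disjoint complementary diagonals); (3) the jump `windK q₂ − windK q₁ = ±1` across the chord (`wind_sub_wind_of_straight_cross`, cf. `ΩG.windC_jump`);
(4) the end point `midPt z ∈ ∂r` is joined to the before-part inside `r̄` without meeting the loop when `r` is a head plaquette. -/


end YBWalk

end Literature.Probability.RandomPlanarGeometry.SAW.YangBaxter
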